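import Summits.AtomisticToContinuum.FouriersLaw.Statement
import Summits.AtomisticToContinuum.FouriersLaw.Theses.JunctionLocality
import Summits.AtomisticToContinuum.FouriersLaw.Theses.BondHeatUncertainty
import Summits.AtomisticToContinuum.FouriersLaw.Theses.CurrentTiltQuench
import Summits.AtomisticToContinuum.FouriersLaw.Theorems.JunctionLocalityNonBallisticOfNoTruncatedDrude
import HarnessLib.Audit.CruxProbe

/-!
# BC7 `#h21_crux_probe` on the two pieces of the 2-way split of `JunctionLocality.NonBallistic` (strategist r1, stmt-9127)
P1 outright / P2 vacuity / P3 rigidity / P4 / P5 piece → FouriersLaw (via the route's `closes`) and FouriersLaw → piece (informational).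
-/

set_option h21.cruxProbe.batteryMs 90000
set_option h21.cruxProbe.totalMs 400000

#h21_crux_probe Summit.AtomisticToContinuum.FouriersLaw.Theses.BondHeatUncertainty.ExtensiveSnapshotIrreversibility route := "route-AtomisticToContinuum-JunctionLocality"

#h21_crux_probe Summit.AtomisticToContinuum.FouriersLaw.Theses.CurrentTiltQuench.NoTruncatedDrude route := "route-AtomisticToContinuum-JunctionLocality"

#h21_crux_probe Summit.AtomisticToContinuum.FouriersLaw.Theses.JunctionLocality.NonBallistic route := "route-AtomisticToContinuum-JunctionLocality"
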